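import Summits.ResolutionOfSingularities.ResolutionOfSingularities.Theorems.EquisingularLiftEquisingularLiftNatRatLiftReduction
import Mathlib
import HarnessLib

/-!
# [OURS · L1 W4.5(b) · EL♮(3)] T-RATLIFT-ALG, PART 3 — THE SATURATED-LIFT DATA of a parametrisation by forms, in the exact binder
# shape of res-type-051's class-free `SatLift.liftableCentre_of_saturatedLift` («SATURATED LIFT ⇒ LIFTABLE CENTRE»)
# (crux `EquisingularLiftNatThree` = stmt-ResolutionOfSingularities-20148, parent stmt-20038, line `sections`;
# res-L1-w45b-plan-1 PLANNER-MEMO-g10-1 object O1 «RatLift»; parts 1–2 = `…RatLiftAlgebra` p530115, `…RatLiftReduction`)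

NOT a statement of any manuscript. Helper file of the chain res-L1-w45b (cell `res-hironaka`, rung L, slot W4.5(b));
OURS; AI-written, weaker than expert review; def-free, no `sorry`, standard axioms; filed
`--supports stmt-ResolutionOfSingularities-20148 --as helper` (counted 0, registers nothing).

ONE CALL. **`exists_saturatedLift`**: `O` a DVR with an irreducible `ϖ`, `π : O ↠ k` onto a field, `f : σ → k[x_τ]` forms of ONE
degree `e ≥ 1` (`σ`, `τ` finite) satisfying the COFINITE CLAUSE in all degrees `m ≥ m₀`
(`𝒜_τ,k (e m) ≤ (𝒜_σ,k m).map (aeval f)`; for `τ = Fin 2` and `s^e, t^e` in the span of the `f i` one degree suffices, part 2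
`clause_of_le`). THEN there are finitely many forms `Gt l ∈ O[x_σ]_{D l}` such that, with `𝔭 := ker (aeval f)`:
  (1) `span (range Gt)` is `ϖ`-SATURATED (`C ϖ · y ∈ span Gt → y ∈ span Gt`);
  (2) `π (Gt l) ∈ 𝔭` for all `l`;
  (3) `X_i^{m₀} · a ∈ span (range (π ∘ Gt))` for all `i` and all `a ∈ 𝔭`
— literally the upstairs hypotheses `(Gt, D, hGt, hsat, hle, m₀, hred)` of res-type-051's `SatLift.liftableCentre_of_saturatedLift`
(draft `L/res-type-051/SaturatedLift-draft.lean` 779928572a0939ba, l.332–340) with `𝔭` supplied as the homogeneous ideal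
`⟨ker (aeval f), RatLift.isHomogeneous_ker_aeval f hf he⟩` (`.toIdeal = ker (aeval f)` by `rfl`) and `h𝔭` = `isRadical_ker_aeval`.
(`Gt` spans `ker (aeval F)` for a homogeneous lift `F` of `f`; (1) = part 1 `mem_ker_aeval_of_C_mul_mem`, (2) = part 1
`map_mem_ker_aeval_of_mem`, (3) = part 2 `X_pow_mul_mem_map_ker_aeval`, Nakayama hypothesis by `ker_le_jacobson_bot_of_isLocalRing`.)
The downstairs inputs of that theorem (`Z = {y | 𝔭 ≤ 𝔮_y}` closed, `V(𝓘_Z)` regular) are about the curve itself and stay with the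
consumer / specimen. Composition `RatLift` ∘ `SatLift` = hLIFT for images of `ℙ(τ)` under forms (smooth rational curves for
`τ = Fin 2`), to be written by whichever hand lands second.

* `isRadical_ker_aeval` — `𝔭` is radical (prime; `k` a domain);
* `exists_homogeneous_lift_family` — a family of forms of degree `e` lifts along `π` to a family of forms of degree `e`;
* **`exists_saturatedLift`** — the one-call package above; `exists_saturatedLift_of_isLocalRing`-style generality is kept
  internal: only `IsDomain O` + `IsDiscreteValuationRing O` (Noetherian, local) are assumed, as in the consumer.

References: folklore; cell: res-type-051 `SatLift` draft (OURS, index only), PLANNER-MEMO-g10-1 (res-L1-w45b-plan-1).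
-/

set_option linter.dupNamespace false -- mandated namespace `Summit.<Summit>.<Problem>` of this single-conjunct summit

namespace Summit.ResolutionOfSingularities.ResolutionOfSingularities.Cruxes.EquisingularLiftNat.Sections

namespace RatLift

open MvPolynomial

universe u v w w'

section Radical

variable {R : Type u} [CommRing R] {σ : Type w} {τ : Type w'} (F : σ → MvPolynomial τ R)

/-- `𝔭 = ker (aeval F)` is a RADICAL ideal over a domain (it is prime, part 1 `isPrime_ker_aeval`). [folklore] [OURS · L1 W4.5b] -/
theorem isRadical_ker_aeval [IsDomain R] : (RingHom.ker (aeval (R := R) F)).IsRadical :=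
  (isPrime_ker_aeval F).isRadical

end Radical

section Data

variable {O : Type u} [CommRing O] {k : Type v} [CommRing k] (π : O →+* k) (hπ : Function.Surjective π)
  {σ : Type w} {τ : Type w'}

include hπ in
/-- A family of forms of degree `e` over `k` lifts along a surjective `π` to a family of forms of degree `e` over `O`
(`CILift.exists_homogeneous_lift` with choice). [folklore] [OURS · L1 W4.5b] -/
theorem exists_homogeneous_lift_family (f : σ → MvPolynomial τ k) {e : ℕ} (hf : ∀ i, (f i).IsHomogeneous e) :
    ∃ F : σ → MvPolynomial τ O, (∀ i, (F i).IsHomogeneous e) ∧ ∀ i, MvPolynomial.map π (F i) = f i := by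
  choose F hF hFf using fun i => CILift.exists_homogeneous_lift π hπ (f i) (hf i)
  exact ⟨F, fun i => (mem_homogeneousSubmodule _ _).mp (hF i), hFf⟩

end Data

section Saturated

variable {O : Type u} [CommRing O] [IsDomain O] [IsDiscreteValuationRing O] {k : Type v} [Field k]
  (π : O →+* k) (hπ : Function.Surjective π) (ϖ : O) (hϖ : Irreducible ϖ)
  {σ : Type w} [Finite σ] {τ : Type w'} [Finite τ]

include hπ hϖ in
/-- **THE SATURATED-LIFT DATA OF A PARAMETRISATION BY FORMS (one call).** `O` a DVR, `ϖ` irreducible, `π : O ↠ k` onto a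
field, `f : σ → k[x_τ]` forms of one degree `e ≥ 1` with the cofinite clause in all degrees `m ≥ m₀`. Then there are forms
`Gt l ∈ O[x_σ]_{D l}` (`l < c`) with `span (range Gt)` `ϖ`-saturated, `π (Gt l) ∈ 𝔭 := ker (aeval f)` and
`X_i^{m₀} · 𝔭 ≤ span (range (π ∘ Gt))` — the upstairs hypotheses of res-type-051's `SatLift.liftableCentre_of_saturatedLift`,
verbatim. [folklore; Nakayama] [OURS · L1 W4.5b] -/
theorem exists_saturatedLift (f : σ → MvPolynomial τ k) {e : ℕ} (he : 0 < e) (hf : ∀ i, (f i).IsHomogeneous e) {m₀ : ℕ}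
    (hcl : ∀ m, m₀ ≤ m →
      homogeneousSubmodule τ k (e * m) ≤ (homogeneousSubmodule σ k m).map (aeval (R := k) f).toLinearMap) :
    ∃ (c : ℕ) (Gt : Fin c → MvPolynomial σ O) (D : Fin c → ℕ),
      (∀ l, Gt l ∈ homogeneousSubmodule σ O (D l)) ∧
      (∀ y, C ϖ * y ∈ Ideal.span (Set.range Gt) → y ∈ Ideal.span (Set.range Gt)) ∧
      (∀ l, MvPolynomial.map π (Gt l) ∈ RingHom.ker (aeval (R := k) f)) ∧
      (∀ i, ∀ a ∈ RingHom.ker (aeval (R := k) f),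
        X i ^ m₀ * a ∈ Ideal.span (Set.range fun l => MvPolynomial.map π (Gt l))) := by
  obtain ⟨F, hF, hFf⟩ := exists_homogeneous_lift_family π hπ f hf
  obtain ⟨c, Gt, D, hGtD, hGtmem, hspan⟩ := exists_fin_isHomogeneous_span_eq_ker_aeval F hF he
  have hjac : RingHom.ker π ≤ (⊥ : Ideal O).jacobson := ker_le_jacobson_bot_of_isLocalRing π
  refine ⟨c, Gt, D, fun l => (mem_homogeneousSubmodule _ _).mpr (hGtD l), ?_, ?_, ?_⟩
  · intro y hy
    rw [hspan] at hy ⊢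
    exact mem_ker_aeval_of_C_mul_mem F hϖ.ne_zero hy
  · intro l
    exact map_mem_ker_aeval_of_mem π F f hFf (hGtmem l)
  · intro i a ha
    rw [← map_span_range_eq π Gt, hspan]
    exact X_pow_mul_mem_map_ker_aeval π hπ hjac F f hFf hF he hcl ha i

include hπ hϖ in
/-- **Parameters `ℙ¹` (`τ = Fin 2`), one-degree form of the clause.** If `s^e` and `t^e` lie in the span of the `f i` and the
cofinite clause holds in ONE degree `m₀ ≥ 1`, the saturated-lift data exist (part 2 `clause_of_le` + `exists_saturatedLift`).
This is the form a specimen hand checks: one finite-dimensional identity. [folklore] [OURS · L1 W4.5b] -/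
theorem exists_saturatedLift_of_clause_at (f : σ → MvPolynomial (Fin 2) k) {e : ℕ} (he : 0 < e)
    (hf : ∀ i, (f i).IsHomogeneous e)
    (hs : X 0 ^ e ∈ (homogeneousSubmodule σ k 1).map (aeval (R := k) f).toLinearMap)
    (ht : X 1 ^ e ∈ (homogeneousSubmodule σ k 1).map (aeval (R := k) f).toLinearMap) {m₀ : ℕ} (hm₀ : 1 ≤ m₀)
    (hcl : homogeneousSubmodule (Fin 2) k (e * m₀) ≤ (homogeneousSubmodule σ k m₀).map (aeval (R := k) f).toLinearMap) :
    ∃ (c : ℕ) (Gt : Fin c → MvPolynomial σ O) (D : Fin c → ℕ),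
      (∀ l, Gt l ∈ homogeneousSubmodule σ O (D l)) ∧
      (∀ y, C ϖ * y ∈ Ideal.span (Set.range Gt) → y ∈ Ideal.span (Set.range Gt)) ∧
      (∀ l, MvPolynomial.map π (Gt l) ∈ RingHom.ker (aeval (R := k) f)) ∧
      (∀ i, ∀ a ∈ RingHom.ker (aeval (R := k) f),
        X i ^ m₀ * a ∈ Ideal.span (Set.range fun l => MvPolynomial.map π (Gt l))) :=
  exists_saturatedLift π hπ ϖ hϖ f he hf (clause_of_le f hs ht hm₀ hcl)

end Saturated

end RatLift

end Summit.ResolutionOfSingularities.ResolutionOfSingularities.Cruxes.EquisingularLiftNat.Sections
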